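import Summits.QuantumFields.YangMills.Theorems.UnitScaleTiltProp7In19DatumRows
import Summits.QuantumFields.YangMills.Theorems.UnitScaleTiltProp7CovOfThm2
import Summits.QuantumFields.YangMills.Theorems.UnitScaleTiltProp7TwistRegauge
import HarnessLib

/-!
# Route `UnitScaleTilt`, crux K1 «MinimiserStabilityRegPr» (stmt-QuantumFields-19200), architecture (A′) «HCOW-VIA-Σ» (★★OWNER RULING g28-№13: «representative = print's Thm-2
# datum on the Σ-twisted fibre with the projected Landau condition; no untwisting, no pinned corrector») — **THE Σ-REPRESENTATIVE OF EVERY COMPETITOR FROM THE EX KNIT's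
# PRINT SOCKET `hThm2S`, AT EVERY MEMBER**: for `W, W′ ∈ (6)(e) ∩ 𝔅_k(V)`, `W′ = (e^{iX}W)^u` with `X` Hermitian-traceless, (19)-small (`In19 … (2B₁′e)`), (20) `AvgCondPrint`,
# (21) `IsLandauPrint` (the projected Landau gauge (1.38)), and `A(W′) = A(e^{iX}W)` — [Balaban1985Variational] Prop. 2 p.281 read at the pair `(U₀ := W, U := W′)`

Cell `ym3-torus`, width seat `ym3-torus-px13` (gen 4); ★p1 g17 NAMER WORD 8 («HDATUM socket chain STAYS useful (Thm-2 socket = (A′)'s representative)»).  THEOREMS ONLY (0 `def`,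
0 `sorry`, 0 `instance`); `--supports stmt-QuantumFields-19200`, count-neutral.  YM₃ on T³ is a ladder rung (R3), not the Clay problem; nothing here claims the stub, the crux, d = 4 or
the gap; `hThm2S` (lit `B8Thm2SetupTorus.Thm2SetupSUAt`) is a HYPOTHESIS SHAPE (lit-balaban's conditional supplier lineage), not proved here.

WHY.  ✓ `Prop7DatumOfThm2S.hDatum_of_thm2S_member` (p686351) served the PINNED route: it untwisted (`u` small at the k-centres, (1.72)) and carried frames, hence members of record only.
Under (A′) the competitor enters the `hcoW` junction (⧗∕✓ `Prop7HcoWOfSigmaRows.hcoW_of_sigmaRowsW`) through its representative ON Σ: `e^{iX}W` with (19)–(21).  That is the first half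
of the same chain — axial representative ✓ `Prop7AxialReprPrint.exists_repr_inAx_based` ∘ ✓ `inAk_pull_of_regPr`, COV ✓ `Prop7CovOfThm2.cov_of_thm2SetupSUAt` (w1 g2), (19) read
through ✓ `Prop7In19DatumRows.datumRows_of_in19` for `U₁ = expHermField X` — WITHOUT frames or (1.72), so it holds at EVERY member (`F.L = L`), with three L-only windows on `e`
([Balaban1985Averaging] Prop. 2: `C₀·2e ≤ ⅓`, `4e ≤ c₂′`; COV: `2e ≤ c₁′`).  The action equality is gauge invariance (lit ✓ `T4WilsonGaugeFlatDirection.wilsonAction_gaugeAct`).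

WHAT IS PROVED (ns `…Theorems.Prop7SigmaRepOfThm2S`): ★★★ `exists_sigmaRep_of_thm2S` — `∃ B₁′ c₁′ > 0, ∀ F (F.L = L) n K (n < K) e V W, 0 < e → 2e ≤ c₁′ → C0 3·(2e) ≤ ⅓ → 2(2e) ≤ c2' 3 L →
W ∈ regFibrePr F n K _ e V → ∀ W′ ∈ regFibrePr F n K _ e V, ∃ u X, W′ = gaugeAct u (emb15 W (expHermField X)) ∧ In19 F n K (2B₁′e) W (expHermField X) X ∧ AvgCondPrint F n K _ V W X ∧
IsLandauPrint F n K W X ∧ wilsonAction4 W′ = wilsonAction4 (emb15 W (expHermField X))`.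
HONEST SCOPE.  Composition of landed theorems; the (S-)Landau letter is COV's `IsLandauPrint` ((1.38) multiplier form on the based pullback) — the bridge to `IsLandauPrintS` is the EX namer's
word (★p1 g17 WORD 8 (LANDAU-S)); nothing of Thm 2∕`hcoW`∕E′∕EX claimed.

References: T. Bałaban, CMP 102 (1985) 277–309 [Balaban1985Variational] ((18)–(21) pp.280–281, Prop. 2 p.281, (141)–(142) p.299); CMP 99 (1985) 75–102 [Balaban1985RegularSpaces] (Thm 2 p.83,
(1.19) p.79, (1.29) p.81, (1.36)–(1.38) p.82); CMP 98 (1985) 17–51 [Balaban1985Averaging] (Prop. 2 p.26, (8)–(9) p.19).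
-/

set_option autoImplicit false

noncomputable section

open scoped BigOperators Matrix.Norms.L2Operator Matrix

namespace Summit.QuantumFields.YangMills.Theorems.Prop7SigmaRepOfThm2S

open Literature.MathematicalPhysics.QuantumFieldTheory.Balaban1983to89
open Literature.MathematicalPhysics.QuantumFieldTheory.Balaban1983to89.T3ContinuumYM3Torus
open Literature.MathematicalPhysics.QuantumFieldTheory.Balaban1983to89.T3PrintedRegularMinimiser (RegPr regFibrePr mem_regFibrePr_iff)
open Literature.MathematicalPhysics.QuantumFieldTheory.Balaban1983to89.T3SectALandauChart (emb15 eta In19 CloseAvg closeAvg_of_mem_fibre)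
open Literature.MathematicalPhysics.QuantumFieldTheory.Balaban1983to89.T3UnitLawGaugeInvariance (gaugeAct_gaugeAct)
open T4Continuum
open B7Prop1Explicit renaming Site → LSite
open B7Prop2Explicit (C0 c2' C0_pos c2'_pos)
open B8Thm4TorusAt (torusLam)
open B8Thm2SetupTorus (Thm2SetupSUAt)
open Summit.QuantumFields.YangMills.Theorems.Prop7TPrint (expHermField)
open Summit.QuantumFields.YangMills.Theorems.Prop7SPrint (IsAxialPrint RestrictedPrint AvgCondPrint IsLandauPrint)
open Summit.QuantumFields.YangMills.Theorems.Prop7AxialReprPrint (exists_repr_inAx_based inAk_pull_of_regPr)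
open Summit.QuantumFields.YangMills.Theorems.Prop7TwistRegauge (gaugeAct_mem_regFibrePr_of_centre_eq)
open Summit.QuantumFields.YangMills.Theorems.Prop7CovOfThm2 (cov_of_thm2SetupSUAt)
open Summit.QuantumFields.YangMills.Theorems.Prop7In19DatumRows (datumRows_of_in19)

/-- ★★★ **THE Σ-REPRESENTATIVE OF EVERY COMPETITOR FROM `hThm2S`, AT EVERY MEMBER** — for `W, W′ ∈ (6)(e) ∩ 𝔅_k(V)`: `W′ = (e^{iX}W)^u` with `X` Hermitian-traceless and (19)-small at
`ε₂ := 2B₁′e` (`In19`), (20) `AvgCondPrint`, (21) `IsLandauPrint`, and `A(W′) = A(e^{iX}W)`; windows `2e ≤ c₁′`, `C₀·2e ≤ ⅓`, `4e ≤ c₂′` (L-only).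
[cite: Balaban1985Variational, Prop. 2 p.281, (18)-(21) pp.280-281; Balaban1985RegularSpaces, Thm 2 p.83, (1.38) p.82; Balaban1985Averaging, Prop. 2 p.26] -/
theorem exists_sigmaRep_of_thm2S {L : ℕ} {B₁ c₁ : ℝ} (hB₁ : 0 < B₁) (hc₁ : 0 < c₁)
    (hThm2S : ∀ (F : T3Family), F.L = L → ∀ (n K : ℕ), n < K →
      ∃ (β₀ B₂ : ℝ) (len : LSite (F.P K).d → ℝ), Thm2SetupSUAt (F.P K) 2 (K - n) (eta F n K) β₀ B₁ B₂ c₁ len (fun _ => True)) :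
    ∃ B₁' c₁' : ℝ, 0 < B₁' ∧ 0 < c₁' ∧
    ∀ (F : T3Family), F.L = L → ∀ (n K : ℕ) (hnK : n < K) (e : ℝ)
      (V : GaugeField (F.P n) 0 (Matrix.specialUnitaryGroup (Fin 2) ℂ)) (W : GaugeField (F.P K) 0 (Matrix.specialUnitaryGroup (Fin 2) ℂ)),
      0 < e → 2 * e ≤ c₁' → C0 3 * (2 * e) ≤ 1 / 3 → 2 * (2 * e) ≤ c2' 3 L → W ∈ regFibrePr F n K hnK.le e V →
      ∀ W' : GaugeField (F.P K) 0 (Matrix.specialUnitaryGroup (Fin 2) ℂ), W' ∈ regFibrePr F n K hnK.le e V →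
        ∃ (u : GaugeTransf (F.P K) 0 (Matrix.specialUnitaryGroup (Fin 2) ℂ)) (X : PBond (F.P K) 0 → Matrix (Fin 2) (Fin 2) ℂ),
          W' = GaugeField.gaugeAct u (emb15 W (expHermField X)) ∧
          In19 F n K (2 * B₁' * e) W (expHermField X) X ∧ AvgCondPrint F n K hnK.le V W X ∧ IsLandauPrint F n K W X ∧
          wilsonAction4 W' = wilsonAction4 (emb15 W (expHermField X)) := by
  obtain ⟨B₁', c₁', hB₁', hc₁', HCOV⟩ := cov_of_thm2SetupSUAt (L := L) (B₃ := 1) zero_le_one hB₁ hc₁ hThm2S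
  refine ⟨B₁', c₁', hB₁', hc₁', ?_⟩
  intro F hF n K hnK e V W he h2e hα3 hα2 hW W' hW'
  have hLP : (F.P K).L = L := by rw [← hF]; rfl
  have hd : (F.P K).d = 3 := rfl
  have hk : K - n ≤ (F.P K).m + (F.P K).K := by show K - n ≤ F.m + K; omega
  -- membership data of the two fibre points
  have hfibW := ((mem_regFibrePr_iff F).1 hW).1
  have hregW : RegPr F n K e W := ((mem_regFibrePr_iff F).1 hW).2
  have hregW' : RegPr F n K e W' := ((mem_regFibrePr_iff F).1 hW').2
  -- (a) the axial representative `W′^v`, `v = 1` at the k-centres ([Balaban1985Averaging] Prop. 2 windows)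
  have hα3' : C0 (F.P K).d * (2 * e) ≤ 1 / 3 := by rw [hd]; exact hα3
  have hα2' : 2 * (2 * e) ≤ c2' (F.P K).d (F.P K).L := by rw [hd, hLP]; exact hα2
  obtain ⟨v, hv1, hvax⟩ := exists_repr_inAx_based (P := F.P K) (by norm_num : (2 : ℕ) ≤ 21) hk he hα3' hα2' W W'
    (inAk_pull_of_regPr F he.le hregW) (inAk_pull_of_regPr F he.le hregW')
  have haxv : IsAxialPrint F n K W (GaugeField.gaugeAct v W') := hvax (torusLam (K - n))
  have hone : GaugeField.gaugeAct (fun _ => (1 : Matrix.specialUnitaryGroup (Fin 2) ℂ)) W' = W' := by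
    funext b; simp [GaugeField.gaugeAct]
  have hWv : GaugeField.gaugeAct v W' ∈ regFibrePr F n K hnK.le e V :=
    gaugeAct_mem_regFibrePr_of_centre_eq F hnK.le he.le (g := v) (u := fun _ => 1) (fun y => by rw [hv1 y]) (X := W') (V := V)
      (by rw [hone]; exact hW')
  -- (b) COV = [Balaban1985Variational] Prop. 2 from Thm 2, at `(W, W′^v)` with `ε₀ := e`, `ε₁ := e∕L³`, `B₃ := 1`, `ε₂ := 2B₁′e`
  have hL0 : (0 : ℝ) < (L : ℝ) := by
    have : 1 < L := by rw [← hF]; exact F.hL.2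
    exact_mod_cast (by omega : 0 < L)
  have hε₁ : 0 < e / (L : ℝ) ^ 3 := by positivity
  have hprod : (L : ℝ) ^ 3 * (e / (L : ℝ) ^ 3) = e := by field_simp
  have hreg3 : RegPr F n K ((L : ℝ) ^ 3 * 1 * (e / (L : ℝ) ^ 3)) W := by rw [mul_one, hprod]; exact hregW
  have hclose : CloseAvg F n K hnK.le ((L : ℝ) ^ 3 * (e / (L : ℝ) ^ 3)) V W := closeAvg_of_mem_fibre (by positivity) hfibW
  have hsum : e + (L : ℝ) ^ 3 * (e / (L : ℝ) ^ 3) = 2 * e := by rw [hprod]; ring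
  obtain ⟨u, U₁, X, -, hgauge, h19, h20, h21⟩ := HCOV F hF n K hnK e (e / (L : ℝ) ^ 3) (2 * B₁' * e) he hε₁
    (by rw [hsum]; exact h2e) (by rw [hsum]; linarith) V W hreg3 hclose (GaugeField.gaugeAct v W') hWv haxv
  -- (c) `U₁ = e^{iX}`
  obtain ⟨hU₁, -, -, -, -⟩ := datumRows_of_in19 W U₁ X h19
  -- (d) the competitor's gauge `x ↦ v(x)⁻¹u(x)` and gauge invariance of the action
  have h1 : GaugeField.gaugeAct (fun x => (v x)⁻¹ * u x) (emb15 W U₁) = GaugeField.gaugeAct (fun x => (v x)⁻¹) (GaugeField.gaugeAct u (emb15 W U₁)) :=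
    (gaugeAct_gaugeAct _ _ _).symm
  have h2 : (fun x => (v x)⁻¹ * v x) = fun _ => (1 : Matrix.specialUnitaryGroup (Fin 2) ℂ) := funext fun x => inv_mul_cancel _
  have hW'eq : W' = GaugeField.gaugeAct (fun x => (v x)⁻¹ * u x) (emb15 W (expHermField X)) := by
    rw [← hU₁, h1, hgauge, gaugeAct_gaugeAct, h2, hone]
  refine ⟨fun x => (v x)⁻¹ * u x, X, hW'eq, ?_, h20, h21, ?_⟩
  · rw [← hU₁]; exact h19
  · rw [hW'eq]
    exact T4WilsonGaugeFlatDirection.wilsonAction_gaugeAct 1 _ _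

end Summit.QuantumFields.YangMills.Theorems.Prop7SigmaRepOfThm2S

end
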